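import Mathlib
import Summits.MatrixMultiplication.MatrixMultiplication.Theorems.SubgroupIdentityDesigns.Negative.RootSmear

/-!
# Root-smear DESIGN FILTER for level-`k` identity tests (negative lemma, crux `SubgroupIdentityDesigns`, 14079)

Companion of `Negative.RootSmear` (the Fourier identity `rootSmear_sum_eq_zero` and the abstract
`no_idTest_of_rootSmear`).  Here the pattern point `1 + n_e` is factorised inside `GL_m(𝔽_p)` as
`u · x`, `u = 1 + n₁` (the part of `n_e` on `Π ∖ {(i,j)}`, strictly lower triangular, so `det u = 1`) and
`x = 1 + e_{ij} E_{ij}` (a root element, `det x = 1`), using that column `i` of `n₁` vanishes; whence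
`no_levelK_design_of_rootSmear`: if `H₁` contains every unipotent supported on
`{(a,b) : b < a < k} ∪ ({i,j} × {b < k})` and `H₂ ⊇ X_{ij}` (`k ≤ i < j`, 0-indexed), then NO level-`k` identity
design exists for `(H₁, H₂, H₃)` — verbatim the crux's Fourier clause, as in `LevelKCornerSlice.cornerSlice` —
for any `H₃`, any prime `p` (including `2`) and any `m ≥ k + 2`; no TPP and no `3k ≤ m` needed.  This kills the
Borel template of the card `borel-configuration-identity-test` at every `k` (cell B2b-5,
`run/shared/lean/b2b/levelgraded-cu/ORACLE.md` §5).  Sorry-free; standard axioms.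
-/

set_option linter.dupNamespace false

noncomputable section

open scoped BigOperators Classical

namespace Summit.MatrixMultiplication.MatrixMultiplication.Theorems.SubgroupIdentityDesigns.Negative

variable {p m : ℕ} [Fact p.Prime]

/-- The strictly lower part `n₁` of `n_e` (the pattern `Π ∖ {(i,j)}`, which lies below the diagonal). -/
def smearLow (k : ℕ) (i j : Fin m) (e : CMat p m) : CMat p m :=
  Matrix.of fun a b => if (a, b) ∈ smearPat k i j ∧ ¬ (a = i ∧ b = j) then e a b else 0

/-- The root part `t · E_{ij}` of `n_e`. -/
def smearRoot (i j : Fin m) (t : ZMod p) : CMat p m :=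
  Matrix.of fun a b => if a = i ∧ b = j then t else 0

/-- `n₁` is strictly lower triangular. -/
theorem smearLow_apply_eq_zero_of_le {k : ℕ} {i j : Fin m} (hki : k ≤ i.val) (hij : i.val < j.val)
    (e : CMat p m) {a b : Fin m} (hab : a.val ≤ b.val) : smearLow k i j e a b = 0 := by
  simp only [smearLow, Matrix.of_apply]
  rw [if_neg]
  rintro ⟨hmem, hne⟩
  rcases mem_smearPat.1 hmem with ⟨h1, _⟩ | ⟨h1, h2⟩ | h3
  · omega
  · rcases h1 with rfl | rfl <;> omega
  · exact hne h3

/-- `det (1 + n₁) = 1` (unit lower triangular). -/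
theorem det_one_add_smearLow {k : ℕ} {i j : Fin m} (hki : k ≤ i.val) (hij : i.val < j.val)
    (e : CMat p m) : (1 + smearLow k i j e).det = 1 := by
  have htri : (1 + smearLow k i j e).BlockTriangular OrderDual.toDual := by
    intro a b hlt
    have hlt' : a < b := by simpa using hlt
    rw [Matrix.add_apply, Matrix.one_apply_ne (ne_of_lt hlt'),
      smearLow_apply_eq_zero_of_le hki hij e (le_of_lt hlt'), add_zero]
  rw [Matrix.det_of_lowerTriangular _ htri]
  refine Finset.prod_eq_one fun a _ => ?_
  rw [Matrix.add_apply, Matrix.one_apply_eq, smearLow_apply_eq_zero_of_le hki hij e le_rfl, add_zero]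

/-- `det (1 + t E_{ij}) = 1` (unit upper triangular, `i < j`). -/
theorem det_one_add_smearRoot {i j : Fin m} (hij : i.val < j.val) (t : ZMod p) :
    (1 + smearRoot i j t : CMat p m).det = 1 := by
  have hij' : i ≠ j := fun h => by rw [h] at hij; exact lt_irrefl _ hij
  have htri : (1 + smearRoot i j t : CMat p m).BlockTriangular id := by
    intro a b hlt
    have hlt' : b < a := hlt
    rw [Matrix.add_apply, Matrix.one_apply_ne (ne_of_gt hlt'), zero_add]
    simp only [smearRoot, Matrix.of_apply]
    rw [if_neg]
    rintro ⟨rfl, rfl⟩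
    exact absurd hij (by simpa using le_of_lt hlt')
  rw [Matrix.det_of_upperTriangular htri]
  refine Finset.prod_eq_one fun a _ => ?_
  rw [Matrix.add_apply, Matrix.one_apply_eq]
  simp only [smearRoot, Matrix.of_apply]
  rw [if_neg, add_zero]
  rintro ⟨rfl, h⟩
  exact hij' h

/-- `(1 + n₁)(1 + t E_{ij}) = 1 + n_e`: the column `i` of `n₁` vanishes. -/
theorem one_add_smearLow_mul (k : ℕ) (i j : Fin m) (hki : k ≤ i.val) (hij : i.val < j.val) (e : CMat p m) :
    (1 + smearLow k i j e) * (1 + smearRoot i j (e i j)) = 1 + smearNil k i j e := by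
  have hcol : ∀ a : Fin m, smearLow k i j e a i = 0 := by
    intro a
    simp only [smearLow, Matrix.of_apply]
    rw [if_neg]
    rintro ⟨hmem, hne⟩
    rcases mem_smearPat.1 hmem with ⟨h1, h2⟩ | ⟨h1, h2⟩ | ⟨h1, h2⟩
    · omega
    · omega
    · exact hne ⟨h1, h2⟩
  have hprod : smearLow k i j e * smearRoot i j (e i j) = 0 := by
    ext a b
    simp only [Matrix.mul_apply, Matrix.zero_apply]
    refine Finset.sum_eq_zero fun c _ => ?_
    simp only [smearRoot, Matrix.of_apply]
    by_cases hc : c = i ∧ b = j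
    · rw [hc.1, hcol a, zero_mul]
    · rw [if_neg hc, mul_zero]
  rw [add_mul, one_mul, mul_add, mul_one, hprod, add_zero]
  ext a b
  simp only [Matrix.add_apply, smearLow, smearRoot, smearNil, Matrix.of_apply]
  by_cases hr : a = i ∧ b = j
  · obtain ⟨rfl, rfl⟩ := hr
    have hmem : (a, b) ∈ smearPat k a b := mem_smearPat.2 (Or.inr (Or.inr ⟨rfl, rfl⟩))
    simp [hmem]
  · rw [if_neg hr, add_zero]
    by_cases hmem : (a, b) ∈ smearPat k i j
    · rw [if_pos ⟨hmem, hr⟩, if_pos hmem]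
    · rw [if_neg (fun h => hmem h.1), if_neg hmem]

/-- **DESIGN FILTER (root smear).** In `GL_m(𝔽_p)`, `k ≤ i < j` (0-indexed): if `H₁` contains every unipotent
`u` with `u - 1` supported on `{(a,b) : b < a < k} ∪ ({i,j} × {b < k})` and `H₂` contains the root subgroup
`X_{ij}`, then `(H₁, H₂, H₃)` admits NO level-`k` identity design (the crux's Fourier clause), whatever `H₃` is.
No TPP, no `3k ≤ m`, no torus is needed; `p = 2` is allowed. -/
theorem no_levelK_design_of_rootSmear (k : ℕ) (i j : Fin m) (hki : k ≤ i.val) (hij : i.val < j.val)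
    {H₁ H₂ H₃ : Subgroup (Matrix.GeneralLinearGroup (Fin m) (ZMod p))}
    (hQ : ∀ u : Matrix.GeneralLinearGroup (Fin m) (ZMod p),
      (∀ a b : Fin m, ((u : CMat p m) - 1) a b ≠ 0 →
        (b.val < a.val ∧ a.val < k) ∨ ((a = i ∨ a = j) ∧ b.val < k)) → u ∈ H₁)
    (hX : ∀ x : Matrix.GeneralLinearGroup (Fin m) (ZMod p),
      (∀ a b : Fin m, ((x : CMat p m) - 1) a b ≠ 0 → a = i ∧ b = j) → x ∈ H₂)
    (hid : ∃ c : CMat p m → ℂ, (∀ M : CMat p m, k < M.rank → c M = 0) ∧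
      (∑ M : CMat p m, c M * ZMod.stdAddChar (Matrix.trace
        (M * ((1 : Matrix.GeneralLinearGroup (Fin m) (ZMod p)) : CMat p m)))) = 1 ∧
      ∀ a ∈ H₁, ∀ b ∈ H₂, ∀ g ∈ H₃, a * b * g ≠ 1 →
        (∑ M : CMat p m, c M * ZMod.stdAddChar (Matrix.trace
          (M * ((a * b * g : Matrix.GeneralLinearGroup (Fin m) (ZMod p)) : CMat p m)))) = 0) :
    False := by
  obtain ⟨c, hc, h1, h0⟩ := hid
  let S : Set (CMat p m) := {s | ∃ a ∈ H₁, ∃ b ∈ H₂, ∃ g ∈ H₃,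
    s = ((a * b * g : Matrix.GeneralLinearGroup (Fin m) (ZMod p)) : CMat p m)}
  refine no_idTest_of_rootSmear k i j hki hij S ?_ c hc ?_ ?_
  · intro e
    -- `1 + n_e = u · x · 1` with `u = 1 + n₁ ∈ H₁`, `x = 1 + e_{ij} E_{ij} ∈ H₂`
    let u : Matrix.GeneralLinearGroup (Fin m) (ZMod p) :=
      Matrix.GeneralLinearGroup.mkOfDetNeZero (1 + smearLow k i j e)
        (by rw [det_one_add_smearLow hki hij]; exact one_ne_zero)
    let x : Matrix.GeneralLinearGroup (Fin m) (ZMod p) :=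
      Matrix.GeneralLinearGroup.mkOfDetNeZero (1 + smearRoot i j (e i j))
        (by rw [det_one_add_smearRoot hij]; exact one_ne_zero)
    have hu : (u : CMat p m) = 1 + smearLow k i j e := rfl
    have hx : (x : CMat p m) = 1 + smearRoot i j (e i j) := rfl
    have huH : u ∈ H₁ := by
      refine hQ u fun a b hab => ?_
      rw [hu, add_sub_cancel_left] at hab
      simp only [smearLow, Matrix.of_apply] at hab
      by_cases hcond : (a, b) ∈ smearPat k i j ∧ ¬ (a = i ∧ b = j)
      · rcases mem_smearPat.1 hcond.1 with h | h | h
        · exact Or.inl h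
        · exact Or.inr h
        · exact absurd h hcond.2
      · exact absurd (if_neg hcond) hab
    have hxH : x ∈ H₂ := by
      refine hX x fun a b hab => ?_
      rw [hx, add_sub_cancel_left] at hab
      simp only [smearRoot, Matrix.of_apply] at hab
      by_contra hcond
      exact hab (if_neg hcond)
    refine ⟨u, huH, x, hxH, 1, H₃.one_mem, ?_⟩
    rw [mul_one, Matrix.GeneralLinearGroup.coe_mul, hu, hx, one_add_smearLow_mul k i j hki hij e]
  · simpa [fourierMat] using h1
  · rintro s ⟨a, ha, b, hb, g, hg, rfl⟩ hs
    refine h0 a ha b hb g hg fun h => hs ?_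
    rw [h, Matrix.GeneralLinearGroup.coe_one]

end Summit.MatrixMultiplication.MatrixMultiplication.Theorems.SubgroupIdentityDesigns.Negative

end
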